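import Literature.NumberTheory.Transcendental.HolonomyBoundBasic
import Mathlib.Tactic
import HarnessLib

/-!
# The basic arithmetic holonomy bound (CDT Appendix §17), meromorphic case: eq. (PZ final)

Calegari–Dimitrov–Tang, arXiv:2408.15403, Appendix §17.3 (p. 130), in full generality:
"Consider `φ = v/u` any representation of `φ` as the quotient of two convergent power series `u`
and `v` on `𝔻̄` such that `u(0) = 1`. Let `h` be a convergent power series on `𝔻̄` such that
`h(0) = 1` and `h fᵢ` [`= h · φ^*fᵢ`] is holomorphic for each `i = 1,…,m`." Then, with
`V(z) := h(z) u(z)^D (F₁(φ(z)) − F₂(φ(z)))`, the Cauchy estimate gives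
`A_p = |φ'(0)|^{-u(p)} · T (sup_𝕋 max(|u|,|v|))^D · mD · sup_𝕋 |h φ^*fᵢ|` (eq. (sup bound)) and
the dynamic box principle yields the **arithmetic holonomy bound**
`m ≤ 2 sup_𝕋 log max(|u|,|v|) / (log|φ'(0)| − b₁ − ⋯ − b_r)` (eq. (PZ final)): "This is true
for any meromorphic quotient representation `φ = v/u` with `u(0) = 1`."

This file supplies the meromorphic Cauchy estimate and plugs it into the abstract endgame
`HolonomyBound.holonomyBound_of_coeff_bound`:

* `HolonomyBound.auxVmer` — `V(z) = Σᵢ (Σⱼ c i j v(z)ʲ u(z)^{D−j}) Gᵢ(z)` (`= h u^D F(φ)` for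
  `Gᵢ = h φ^*fᵢ`), `differentiableOn_auxVmer`, `auxVmer_eq` (`V = h u^D · Σᵢ Qᵢ(φ) gᵢ` where
  `u ≠ 0`), `norm_auxVmer_le` (`|V| ≤ m T D M^D G` on `𝕋`).
* `HolonomyBound.norm_coeff_combo_mul_pow_le_mer` — the bound `A_p`, meromorphic case.
* `HolonomyBound.holonomyBound_meromorphic` — **eq. (PZ final)** in division-free form
  `m · (log|φ'(0)| − Σ bⱼ) ≤ 2 log M`, `M ≥ max(1, sup_𝕋|u|, sup_𝕋|v|)`.

The last step of Appendix §17 — Nevanlinna's lemma producing `u, v` with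
`sup|u|, sup|v| ≤ exp(T(φ) + ε)` and hence eq. (basic basic) `m ≤ 2T(φ)/(log|φ'(0)| − Σbᵢ)`
with the Nevanlinna characteristic — is not formalised here. No named facts.

## References

* [CalegariDimitrovTang2024] arXiv:2408.15403, Appendix §17.3, eqs. (sup bound), (PZ final)
  (p. 130).
-/

noncomputable section

open Filter Metric Finset PowerSeries
open scoped Topology

namespace Literature.NumberTheory.Transcendental

namespace HolonomyBound

variable {m r D : ℕ}

/-! ### The auxiliary function `V = h u^D (F(φ))` in the meromorphic case -/

/-- `V(z) = Σᵢ (Σⱼ c i j · v(z)ʲ · u(z)^{D−j}) · Gᵢ(z)`; for `Gᵢ = h · gᵢ`, `gᵢ = φ^*fᵢ`,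
`φ = v/u`, this is CDT's `V = h u^D (F(φ))`, `F = Σᵢ Qᵢ fᵢ`, `Qᵢ = Σⱼ c i j xʲ`.
[cite: CalegariDimitrovTang2024, Appendix §17.3 (p. 130)] -/
def auxVmer (c : Fin m → Fin D → ℚ) (u v : ℂ → ℂ) (G : Fin m → ℂ → ℂ) (z : ℂ) : ℂ :=
  ∑ i : Fin m, (∑ j : Fin D, (c i j : ℂ) * v z ^ (j : ℕ) * u z ^ (D - (j : ℕ))) * G i z

/-- `V` is holomorphic where `u`, `v` and the `Gᵢ` are. [folklore] -/
theorem differentiableOn_auxVmer (c : Fin m → Fin D → ℚ) {u v : ℂ → ℂ} {G : Fin m → ℂ → ℂ}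
    {s : Set ℂ} (hu : DifferentiableOn ℂ u s) (hv : DifferentiableOn ℂ v s)
    (hG : ∀ i, DifferentiableOn ℂ (G i) s) :
    DifferentiableOn ℂ (auxVmer c u v G) s := by
  unfold auxVmer
  refine DifferentiableOn.fun_sum fun i _ => DifferentiableOn.mul ?_ (hG i)
  exact DifferentiableOn.fun_sum fun j _ => ((hv.pow _).const_mul _).mul (hu.pow _)

/-- Where `u(z) ≠ 0` and `Gᵢ(z) = h(z) gᵢ(z)`: `V(z) = h(z) u(z)^D · Σᵢ Qᵢ(φ(z)) gᵢ(z)` with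
`φ = v/u`, i.e. `V = h u^D · auxV c φ g`. [folklore] -/
theorem auxVmer_eq (c : Fin m → Fin D → ℚ) {u v h : ℂ → ℂ} {G g : Fin m → ℂ → ℂ} {z : ℂ}
    (huz : u z ≠ 0) (hG : ∀ i, G i z = h z * g i z) :
    auxVmer c u v G z = (h z * u z ^ D) * auxV c (fun z => v z / u z) g z := by
  have key : ∀ j : Fin D, v z ^ (j : ℕ) * u z ^ (D - (j : ℕ)) =
      u z ^ D * (v z / u z) ^ (j : ℕ) := by
    intro j
    have hj : (j : ℕ) ≤ D := le_of_lt j.isLt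
    have hu : u z ^ (j : ℕ) ≠ 0 := pow_ne_zero _ huz
    calc v z ^ (j : ℕ) * u z ^ (D - (j : ℕ))
        = v z ^ (j : ℕ) * u z ^ (D - (j : ℕ)) * (u z ^ (j : ℕ) / u z ^ (j : ℕ)) := by
          rw [div_self hu, mul_one]
      _ = (u z ^ (D - (j : ℕ)) * u z ^ (j : ℕ)) * (v z ^ (j : ℕ) / u z ^ (j : ℕ)) := by ring
      _ = u z ^ D * (v z / u z) ^ (j : ℕ) := by rw [← pow_add, Nat.sub_add_cancel hj, div_pow]
  have inner : ∀ i : Fin m, ∑ j : Fin D, (c i j : ℂ) * v z ^ (j : ℕ) * u z ^ (D - (j : ℕ)) =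
      u z ^ D * ∑ j : Fin D, (c i j : ℂ) * (v z / u z) ^ (j : ℕ) := by
    intro i
    rw [Finset.mul_sum]
    refine Finset.sum_congr rfl fun j _ => ?_
    rw [mul_assoc, key j]
    ring
  unfold auxVmer auxV
  rw [Finset.mul_sum]
  refine Finset.sum_congr rfl fun i _ => ?_
  rw [inner i, hG i]
  ring

/-- **The bound on the unit circle** (CDT eq. (sup bound), second line): if `|c i j| ≤ T`,
`|u(z)|, |v(z)| ≤ M` with `M ≥ 1` and `|Gᵢ(z)| ≤ G`, then `|V(z)| ≤ m·T·D·M^D·G`.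
[cite: CalegariDimitrovTang2024, Appendix §17.3 eq. (sup bound) (p. 130)] -/
theorem norm_auxVmer_le (c : Fin m → Fin D → ℚ) {u v : ℂ → ℂ} {G : Fin m → ℂ → ℂ}
    {T M G' : ℝ} (hT : ∀ i j, |(c i j : ℝ)| ≤ T) (hM1 : 1 ≤ M) {z : ℂ} (huz : ‖u z‖ ≤ M)
    (hvz : ‖v z‖ ≤ M) (hGz : ∀ i, ‖G i z‖ ≤ G') :
    ‖auxVmer c u v G z‖ ≤ m * T * D * M ^ D * G' := by
  have hM0 : 0 ≤ M := le_trans zero_le_one hM1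
  -- the polynomial factor
  have hpoly : ∀ i, ‖∑ j : Fin D, (c i j : ℂ) * v z ^ (j : ℕ) * u z ^ (D - (j : ℕ))‖ ≤
      D * T * M ^ D := by
    intro i
    calc ‖∑ j : Fin D, (c i j : ℂ) * v z ^ (j : ℕ) * u z ^ (D - (j : ℕ))‖
        ≤ ∑ j : Fin D, ‖(c i j : ℂ) * v z ^ (j : ℕ) * u z ^ (D - (j : ℕ))‖ := norm_sum_le _ _
      _ ≤ ∑ _j : Fin D, T * M ^ D := Finset.sum_le_sum fun j _ => by
          rw [norm_mul, norm_mul, norm_pow, norm_pow, Complex.norm_ratCast, mul_assoc]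
          have hj : (j : ℕ) ≤ D := le_of_lt j.isLt
          have h1 : |(c i j : ℝ)| ≤ T := hT i j
          have h2 : ‖v z‖ ^ (j : ℕ) * ‖u z‖ ^ (D - (j : ℕ)) ≤ M ^ D := by
            calc ‖v z‖ ^ (j : ℕ) * ‖u z‖ ^ (D - (j : ℕ)) ≤ M ^ (j : ℕ) * M ^ (D - (j : ℕ)) :=
                  mul_le_mul (pow_le_pow_left₀ (norm_nonneg _) hvz _)
                    (pow_le_pow_left₀ (norm_nonneg _) huz _) (by positivity) (by positivity)
              _ = M ^ D := by rw [← pow_add, Nat.add_sub_cancel' hj]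
          exact mul_le_mul h1 h2 (by positivity) (le_trans (abs_nonneg _) h1)
      _ = D * T * M ^ D := by
          rw [Finset.sum_const, Finset.card_univ, Fintype.card_fin, nsmul_eq_mul]; ring
  unfold auxVmer
  calc ‖∑ i : Fin m, (∑ j : Fin D, (c i j : ℂ) * v z ^ (j : ℕ) * u z ^ (D - (j : ℕ))) * G i z‖
      ≤ ∑ i : Fin m, ‖(∑ j : Fin D, (c i j : ℂ) * v z ^ (j : ℕ) * u z ^ (D - (j : ℕ))) * G i z‖ :=
        norm_sum_le _ _
    _ ≤ ∑ _i : Fin m, (D * T * M ^ D) * G' := Finset.sum_le_sum fun i _ => by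
        rw [norm_mul]
        exact mul_le_mul (hpoly i) (hGz i) (norm_nonneg _)
          (le_trans (norm_nonneg _) (hpoly i))
    _ = m * T * D * M ^ D * G' := by
        rw [Finset.sum_const, Finset.card_univ, Fintype.card_fin, nsmul_eq_mul]; ring

/-- **The bound `A_p` of CDT §17.3, meromorphic case**: let `u, v` be holomorphic on
`|z| < R₀` (`R₀ > 1`) with `u(0) = 1`, `v(0) = 0`, `φ = v/u`; let `fᵢ = mk (cf i)` with germs
`gᵢ(z) = Σ_k cf i k φ(z)^k` near `0` (`gᵢ = φ^*fᵢ`), and let `h` be continuous at `0` with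
`h(0) = 1` and `Gᵢ = h · gᵢ` near `0` for functions `Gᵢ` holomorphic on `|z| < R₀`; suppose
`|u|, |v| ≤ M` (`M ≥ 1`) and `|Gᵢ| ≤ G` on `|z| = 1`. If `|c i j| ≤ T` and
`W c = Σ c i j • X^j fᵢ` vanishes to order `≥ n` at `0`, then its `n`-th coefficient `β`
satisfies `‖β‖ · ‖φ'(0)‖ⁿ ≤ m·T·D·M^D·G`.
[cite: CalegariDimitrovTang2024, Appendix §17.3 eq. (sup bound) (p. 130)] -/
theorem norm_coeff_combo_mul_pow_le_mer (cf : Fin m → ℕ → ℚ) (c : Fin m → Fin D → ℚ)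
    {u v h : ℂ → ℂ} {G g : Fin m → ℂ → ℂ} {R₀ T M G' : ℝ} (hR₀ : 1 < R₀)
    (hu : DifferentiableOn ℂ u (ball (0 : ℂ) R₀)) (hv : DifferentiableOn ℂ v (ball (0 : ℂ) R₀))
    (hu0 : u 0 = 1) (hv0 : v 0 = 0) (hh : ContinuousAt h 0) (hh0 : h 0 = 1)
    (hG : ∀ i, DifferentiableOn ℂ (G i) (ball (0 : ℂ) R₀))
    (hgerm : ∀ i, ∀ᶠ z in 𝓝 (0 : ℂ),
      HasSum (fun k => (cf i k : ℂ) * (v z / u z) ^ k) (g i z))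
    (hGg : ∀ i, ∀ᶠ z in 𝓝 (0 : ℂ), G i z = h z * g i z)
    (hT : ∀ i j, |(c i j : ℝ)| ≤ T) (hM1 : 1 ≤ M) (hMu : ∀ z : ℂ, ‖z‖ = 1 → ‖u z‖ ≤ M)
    (hMv : ∀ z : ℂ, ‖z‖ = 1 → ‖v z‖ ≤ M) (hGz : ∀ i (z : ℂ), ‖z‖ = 1 → ‖G i z‖ ≤ G')
    {n : ℕ} (hn : ∀ k < n, coeff k (combo cf c) = 0) :
    ‖((coeff n (combo cf c) : ℚ) : ℂ)‖ * ‖deriv (fun z => v z / u z) 0‖ ^ n ≤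
      m * T * D * M ^ D * G' := by
  have hball : ball (0 : ℂ) R₀ ∈ 𝓝 (0 : ℂ) := ball_mem_nhds 0 (by linarith)
  have hu00 : u 0 ≠ 0 := by rw [hu0]; exact one_ne_zero
  have hua : DifferentiableAt ℂ u 0 := hu.differentiableAt hball
  have hva : DifferentiableAt ℂ v 0 := hv.differentiableAt hball
  have hφ : DifferentiableAt ℂ (fun z => v z / u z) 0 := hva.div hua hu00
  have hφ0 : (fun z => v z / u z) 0 = 0 := by simp only [hv0, zero_div]
  -- `u ≠ 0` near `0`
  have hune : ∀ᶠ z in 𝓝 (0 : ℂ), u z ≠ 0 :=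
    hua.continuousAt.eventually_ne hu00
  -- `V = (h u^D) · U` near `0`
  have hVU : ∀ᶠ z in 𝓝 (0 : ℂ), auxVmer c u v G z =
      (fun z => h z * u z ^ D) z * auxV c (fun z => v z / u z) g z := by
    filter_upwards [hune, eventually_all.mpr hGg] with z hz hGz'
    exact auxVmer_eq c hz hGz'
  have hw : ContinuousAt (fun z => h z * u z ^ D) 0 := hh.mul (hua.continuousAt.pow D)
  have hw1 : (fun z => h z * u z ^ D) 0 = 1 := by simp only [hh0, hu0, one_pow, mul_one]
  exact norm_coeff_mul_pow_le_of_eq_mul (β := fun k => ((coeff k (combo cf c) : ℚ) : ℂ))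
    (fun k hk => by simp only [hn k hk, Rat.cast_zero]) hR₀ hφ hφ0
    (differentiableOn_auxVmer c hu hv hG) (hasSum_auxV cf c hgerm) hVU hw hw1
    (fun z hz => norm_auxVmer_le c hT hM1 (hMu z hz) (hMv z hz) fun i => hGz i z hz)

/-- **The basic arithmetic holonomy bound, meromorphic case** (Calegari–Dimitrov–Tang 2024,
Appendix §17, eq. (PZ final)), in division-free form: for `ℚ(x)`-linearly independent
`f₁,…,f_m ∈ ℚ⟦x⟧` of denominator type `b` (`fᵢ = Σ a i k/den b k · x^k`, independence as
injectivity of every `ψ_D`); `u, v` holomorphic on `|z| < R₀` (`R₀ > 1`) with `u(0) = 1`,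
`v(0) = 0` and `φ = v/u` ("any meromorphic quotient representation"); germs `gᵢ = φ^*fᵢ`
(`gᵢ(z) = Σ_k (a i k/den b k) φ(z)^k` near `0`) and `h` continuous at `0` with `h(0) = 1` such
that each `h · gᵢ` agrees near `0` with a function `Gᵢ` holomorphic on `|z| < R₀`; bounds
`|u|, |v| ≤ M` (`M ≥ 1`) and `|Gᵢ| ≤ G` on the unit circle. Then
`m · (log|φ'(0)| − Σ_j b_j) ≤ 2 · log M`; i.e.
`m ≤ 2 sup_𝕋 log max(|u|,|v|) / (log|φ'(0)| − Σ bⱼ)` when the denominator is positive.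
[cite: CalegariDimitrovTang2024, Appendix §17 eq. (PZ final) (p. 130)] -/
theorem holonomyBound_meromorphic (b : Fin r → ℕ) (a : Fin m → ℕ → ℤ)
    (hindep : ∀ D : ℕ, LinearIndependent ℚ (genFamily b a D))
    {u v h : ℂ → ℂ} {G g : Fin m → ℂ → ℂ} {R₀ M G' : ℝ} (hR₀ : 1 < R₀)
    (hu : DifferentiableOn ℂ u (ball (0 : ℂ) R₀)) (hv : DifferentiableOn ℂ v (ball (0 : ℂ) R₀))
    (hu0 : u 0 = 1) (hv0 : v 0 = 0) (hh : ContinuousAt h 0) (hh0 : h 0 = 1)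
    (hG : ∀ i, DifferentiableOn ℂ (G i) (ball (0 : ℂ) R₀))
    (hgerm : ∀ i, ∀ᶠ z in 𝓝 (0 : ℂ),
      HasSum (fun k => (cfOf b a i k : ℂ) * (v z / u z) ^ k) (g i z))
    (hGg : ∀ i, ∀ᶠ z in 𝓝 (0 : ℂ), G i z = h z * g i z)
    (hM1 : 1 ≤ M) (hMu : ∀ z : ℂ, ‖z‖ = 1 → ‖u z‖ ≤ M)
    (hMv : ∀ z : ℂ, ‖z‖ = 1 → ‖v z‖ ≤ M) (hGz : ∀ i (z : ℂ), ‖z‖ = 1 → ‖G i z‖ ≤ G') :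
    (m : ℝ) * (Real.log ‖deriv (fun z => v z / u z) 0‖ - ∑ j, (b j : ℝ)) ≤ 2 * Real.log M :=
  holonomyBound_of_coeff_bound b a hindep (norm_nonneg _) hM1 fun D T _ c hc n hn => by
    have h := norm_coeff_combo_mul_pow_le_mer (cfOf b a) c hR₀ hu hv hu0 hv0 hh hh0 hG hgerm
      hGg hc hM1 hMu hMv hGz hn
    rwa [Complex.norm_ratCast] at h

end HolonomyBound

end Literature.NumberTheory.Transcendental
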